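import Mathlib
import HarnessLib

/-!
# An operator that is block-diagonal in an adapted basis: matrix, determinant `∏ det(blocks)`, trace `Σ tr(blocks)`
# (Bernstein, *Matrix Mathematics*, Prop. 2.8.1 (2.8.3)–(2.8.4))

Topic `Literature/LinearAlgebra`; namespace `Literature.LinearAlgebra.AdaptedBasis`.  Theorems only (no definitions, no named
facts, no `sorry`).

SETTING.  `M` a module over a commutative ring `K` with a basis `b` indexed by a PRODUCT `σ × X` (`σ` labels the blocks — e.g.
colour momenta, isotypic components, invariant subspaces — and `X` the coordinates inside a block), and a `K`-linear
`f : M → M` which maps each block into itself with matrix `A s`: `f (b (s, x)) = Σ_y A s y x • b (s, y)` (column `x` of `A s` is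
the coordinate vector of `f (b (s,x))` inside block `s`).

RESULTS.
* ★ `toMatrix_eq_reindex_blockDiagonal` — `[f]_b = blockDiagonal A` (up to the index swap `σ × X ≃ X × σ` of Mathlib's
  `Matrix.blockDiagonal`), `toMatrix_apply_eq` (entries: `[f]_b (s,y) (s',x) = if s = s' then A s y x else 0`);
* ★★ `det_eq_prod_det` — `det f = ∏_s det (A s)` (Bernstein (2.8.4) for a block-DIAGONAL matrix);
* `trace_eq_sum_trace` — `tr f = Σ_s tr (A s)` (Bernstein (2.8.3));
* `det_eq_prod_det_of_repr_eq_zero` — the same with the hypothesis «off-block coordinates vanish» and the blocks read off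
  from `b.repr`.

WHY (cell `ym-ir`, row 43, K31).  The complex covariant Laplacian at a twist-eating background is block-diagonal in
't Hooft's colour-momentum basis `δ_x Γ_p` (`p ∈ (ℤ/N)² ∖ 0` the block label, `x` the site), each block being the twisted torus
Laplacian of `Analysis/Matrix/TwistedCycleLaplacian.lean`; this file turns «block-diagonal in an adapted basis» into
`det = ∏_p det(block p)` for an abstract `LinearMap` (Mathlib has `LinearMap.det_pi`∕`det_prodMap` for EXTERNAL products only).

HONEST SCOPE: elementary linear algebra; nothing here bears on the Yang–Mills mass gap (Clay: NOT proved); `R4` closes only the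
conditional finite-`𝕋⁴` rung `BalabanLadder.UV`.

## References
* D. S. Bernstein, *Matrix Mathematics* (2nd ed., Princeton 2009), §2.8 «Partitioned matrices», Prop. 2.8.1, (2.8.3) (trace of a
  partitioned matrix) and (2.8.4) (determinant of a block-triangular matrix) (held `book:bernstein2009-matrix-mathematics`
  p0155). [Bernstein2009]
-/

namespace Literature.LinearAlgebra.AdaptedBasis

open Module

variable {K : Type*} [CommRing K] {M : Type*} [AddCommGroup M] [Module K M]
variable {σ X : Type*} [Fintype σ] [Fintype X] [DecidableEq σ] [DecidableEq X]

omit [DecidableEq X] in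
/-- Coordinates of `f (b (s',x))` in an adapted basis: `b.repr (f (b (s', x))) (s, y) = if s = s' then A s y x else 0`.
[cite: Bernstein2009, Prop. 2.8.1 (2.8.4)] -/
theorem repr_apply_eq (b : Basis (σ × X) K M) (f : M →ₗ[K] M) (A : σ → Matrix X X K)
    (hf : ∀ s x, f (b (s, x)) = ∑ y, A s y x • b (s, y)) (s : σ) (y : X) (s' : σ) (x : X) :
    b.repr (f (b (s', x))) (s, y) = if s = s' then A s y x else 0 := by
  have hsum : ∑ y', A s' y' x • b (s', y') = ∑ p : σ × X, (if p.1 = s' then A s' p.2 x else 0) • b p := by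
    rw [Fintype.sum_prod_type, Finset.sum_eq_single s']
    · simp only [if_true]
    · intro t _ ht
      simp only [ht, if_false, zero_smul, Finset.sum_const_zero]
    · intro h
      exact absurd (Finset.mem_univ _) h
  rw [hf, hsum, b.repr_sum_self]
  change (if (s, y).1 = s' then A s' (s, y).2 x else 0) = _
  by_cases h : s = s'
  · subst h; simp
  · simp [h]

/-- ★ **The matrix of `f` in an adapted basis is block diagonal**: `[f]_b = reindex (blockDiagonal A)` (Mathlib's
`blockDiagonal` carries the block label second, whence the `Equiv.prodComm` reindexing). [cite: Bernstein2009, Prop. 2.8.1 (2.8.4)] -/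
theorem toMatrix_eq_reindex_blockDiagonal (b : Basis (σ × X) K M) (f : M →ₗ[K] M) (A : σ → Matrix X X K)
    (hf : ∀ s x, f (b (s, x)) = ∑ y, A s y x • b (s, y)) :
    LinearMap.toMatrix b b f =
      Matrix.reindex (Equiv.prodComm X σ) (Equiv.prodComm X σ) (Matrix.blockDiagonal A) := by
  ext ⟨s, y⟩ ⟨s', x⟩
  rw [LinearMap.toMatrix_apply, repr_apply_eq b f A hf, Matrix.reindex_apply, Matrix.submatrix_apply]
  simp only [Equiv.prodComm_symm, Equiv.prodComm_apply, Prod.swap_prod_mk, Matrix.blockDiagonal_apply]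

/-- ★★ **`det f = ∏_s det (A s)`** for an operator block-diagonal in an adapted basis.
[cite: Bernstein2009, Prop. 2.8.1 (2.8.4)] -/
theorem det_eq_prod_det (b : Basis (σ × X) K M) (f : M →ₗ[K] M) (A : σ → Matrix X X K)
    (hf : ∀ s x, f (b (s, x)) = ∑ y, A s y x • b (s, y)) :
    LinearMap.det f = ∏ s, (A s).det := by
  rw [← LinearMap.det_toMatrix b, toMatrix_eq_reindex_blockDiagonal b f A hf, Matrix.det_reindex_self,
    Matrix.det_blockDiagonal]

/-- **`tr f = Σ_s tr (A s)`**. [cite: Bernstein2009, Prop. 2.8.1 (2.8.3)] -/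
theorem trace_eq_sum_trace (b : Basis (σ × X) K M) (f : M →ₗ[K] M) (A : σ → Matrix X X K)
    (hf : ∀ s x, f (b (s, x)) = ∑ y, A s y x • b (s, y)) :
    LinearMap.trace K M f = ∑ s, (A s).trace := by
  rw [LinearMap.trace_eq_matrix_trace K b, toMatrix_eq_reindex_blockDiagonal b f A hf]
  have htr : ∀ N : Matrix (X × σ) (X × σ) K,
      (Matrix.reindex (Equiv.prodComm X σ) (Equiv.prodComm X σ) N).trace = N.trace := fun N => by
    simp only [Matrix.trace, Matrix.diag, Matrix.reindex_apply, Matrix.submatrix_apply]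
    exact Equiv.sum_comp (Equiv.prodComm X σ).symm (fun j => N j j)
  rw [htr, Matrix.trace_blockDiagonal]

/-- The same determinant statement with the hypothesis in «invariant blocks» form: if `f (b (s,x)) ∈ span {b (s,y) : y}` for all
`s, x`, then `det f = ∏_s det (A s)` with `A s y x := b.repr (f (b (s,x))) (s,y)`. [cite: Bernstein2009, Prop. 2.8.1 (2.8.4)] -/
theorem det_eq_prod_det_of_repr_eq_zero (b : Basis (σ × X) K M) (f : M →ₗ[K] M)
    (hf : ∀ s x s' y, s' ≠ s → b.repr (f (b (s, x))) (s', y) = 0) :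
    LinearMap.det f = ∏ s, (Matrix.of fun y x => b.repr (f (b (s, x))) (s, y)).det := by
  apply det_eq_prod_det b f
  intro s x
  -- expand `f (b (s,x))` in the basis and drop the vanishing off-block coordinates
  conv_lhs => rw [← b.sum_repr (f (b (s, x)))]
  rw [Fintype.sum_prod_type, Finset.sum_eq_single s]
  · simp only [Matrix.of_apply]
  · intro t _ ht
    simp only [hf s x t _ ht, zero_smul, Finset.sum_const_zero]
  · intro h
    exact absurd (Finset.mem_univ _) h

end Literature.LinearAlgebra.AdaptedBasis
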